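import Summits.BirchSwinnertonDyer.BirchSwinnertonDyer.Theses.ThetaPartnerAtTwo
import Summits.BirchSwinnertonDyer.BirchSwinnertonDyer.Theorems.ThetaPartnerAtTwoSignedMainConjectureCMTwoRankZeroLossless
import Literature.NumberTheory.EllipticCurves.Kobayashi2003.SignedSelmerPairChangeEulerCharProofs
import HarnessLib

/-!
# Route `ThetaPartnerAtTwo`, crux K2r `SignedMainConjectureCMTwoRankZero` (item stmt-BirchSwinnertonDyer-20312):
# the lossless certificate BY NAME — the route decl ⟺ the four research stubs of line `rankzero`, granted PUB

HONEST FRAMING (cell `pub/bsd-wall`, W-ALL row 1, prover seat `bsd-wall-tp2-p2`, successor g2): nothing is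
proved about the crux itself (Pollack–Rubin 2004 Thm. 7.3 ported to `p = 2` + `μ⁺ = 0` for rank-`0` CM curves;
unprinted at `2`). This file only re-states the route-independent equivalence
`signedMainConjectureCMTwoRankZero_body_iff_rankzero_stubs` (sibling `…RankZeroLossless.lean`, p532532) with
the route decl `Summit.BirchSwinnertonDyer.BirchSwinnertonDyer.Theses.ThetaPartnerAtTwo.SignedMainConjectureCMTwoRankZero`
on the left BY NAME (the decl unfolds to the `∀A` body verbatim), so that the audit sees the edge: granted the five
published inputs by name (Burungale–Flach 2024 `bsdTriple_of_hasCM_of_L_one_ne_zero`, modularity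
`nonempty_modularParametrizationData` / `hasEntireLFunction_rat`, GZK `rank_eq_analyticRank_of_analyticRank_le_one`,
the `p = 2` period fact `realPeriodRat_eq_unit_mul_plusPeriod_two`), the crux is EQUIVALENT to the conjunction
of the registered skeleton's research stubs `stub_finiteInvariantsCMTwo`, `stub_kimControlCMTwo` (v8: at the
normalised pairs), `stub_lowerDivisibilityCMTwo`, `stub_analyticMuFlatCMTwo`. Consequences: every stub is
NECESSARY (a `stub-false` is a refutation of the crux), and the crux's research content at `p = 2` is exactly
{bottom-layer signed control, Kim's control term, the inert-`2` Eisenstein half, analytic `μ(L♭) = 0`} for rank-`0`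
CM curves. Conditional on nothing: the PUB facts enter as hypotheses of an equivalence.

§2 `signedMainConjectureCMTwoRankZero_iff_rankzero_stubs_v7`: the same equivalence with `stub_kimControlCMTwo`
VERBATIM as registered (Kim's term at ALL cyclotomic top-generator pairs): Kim's Euler-characteristic identity
does not depend on the pair (`Kobayashi2003.kimEulerChar_of_kimEulerChar_normalised`, Literature
`Kobayashi2003/SignedSelmerPairChangeEulerCharProofs.lean`: `#Sel⁺_∞^γ`, `#(Sel⁺_∞)_γ` are the
`Γ`-invariants/coinvariants for every unit-valued `γ`, and Greenberg's Lemma 4.2). So the REGISTERED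
skeleton `rankzero` v7 (sha16 fd96cde8f62ba52b) is lossless as it stands: crux ⟺ its four research stubs,
granted PUB.

References: [PollackRubin2004] Thm. 7.3 (p > 2 in print); [Kobayashi2003] Thm. 1.2, Conjecture (p. 2);
[BDKim2013] Cor. 3.15 (p odd in print); [BurungaleFlach2024] Thm. 1.1; [GreenbergLNM1716] Lemma 4.2.
-/

set_option autoImplicit false
-- the Theorems namespace of this sub repeats the summit name by design (D-0017 nested layout)
set_option linter.dupNamespace false

noncomputable section

open scoped Classical MatrixGroups ModularForm

open CongruenceSubgroup WeierstrassCurve Literature.NumberTheory.EllipticCurves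
  Literature.NumberTheory.EllipticCurves.ModularForms
  Literature.NumberTheory.EllipticCurves.Rank1Residual
  Literature.NumberTheory.EllipticCurves.Kobayashi2003 ZpExtension
  Literature.NumberTheory.EllipticCurves.IwasawaDual
  Summit.BirchSwinnertonDyer.Rank1Residual.Supersingular

namespace Summit.BirchSwinnertonDyer.BirchSwinnertonDyer.Theorems

/-- **Crux K2r ⟺ the four research stubs of line `rankzero`, BY NAME.** Granted the published inputs
(`hPUB` = Burungale–Flach ∧ modularity ∧ entire `L` ∧ GZK ∧ the `p = 2` period fact, the body of the registered
cite-only stub `stub_publishedInputsCMTwo`), the route decl `SignedMainConjectureCMTwoRankZero` (item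
stmt-BirchSwinnertonDyer-20312) holds iff (T2_A) `Sel⁺(A/ℚ_∞)^γ` is finite at the normalised pairs ∧ (K4c_A)
Kim's control term at `2` at the normalised pairs ∧ (E_A) `KobayashiLowerDivisibility A 2 1` ∧ (μ♭_A) a unit
coefficient of `L♭`, each for every CM `A` of analytic rank `0` good supersingular at `2` with `a₂ = 0` — the
stub signatures of skeleton `rankzero` v8 verbatim. Proof: the decl unfolds to the `∀A` body and
`signedMainConjectureCMTwoRankZero_body_iff_rankzero_stubs` (p532532). [cite: PollackRubin2004, Thm. 7.3 (p > 2 in print)]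
[cite: Kobayashi2003, Thm. 1.2 and Conjecture (p. 2)] [cite: BDKim2013, Cor. 3.15 (p odd in print)]
[cite: BurungaleFlach2024, Thm. 1.1] -/
theorem signedMainConjectureCMTwoRankZero_iff_rankzero_stubs
    (hPUB : bsdTriple_of_hasCM_of_L_one_ne_zero ∧ nonempty_modularParametrizationData ∧
      hasEntireLFunction_rat ∧ rank_eq_analyticRank_of_analyticRank_le_one ∧
      Literature.NumberTheory.EllipticCurves.realPeriodRat_eq_unit_mul_plusPeriod_two) :
    Summit.BirchSwinnertonDyer.BirchSwinnertonDyer.Theses.ThetaPartnerAtTwo.SignedMainConjectureCMTwoRankZero ↔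
    ((∀ (A : WeierstrassCurve ℚ) [A.IsElliptic] [A.IsGloballyMinimal],
        A.HasCM → A.analyticRank = 0 → GoodSS A 2 → A.frobeniusTrace 2 = 0 →
        ∀ (κ : ZpExtension ℚ 2) (γ : Field.absoluteGaloisGroup ℚ),
          κ.IsCyclotomic → κ.IsTopGenerator γ → IsCyclotomicVariable 2 γ →
          Finite (endInvariants (conjSignedSelmerInfty A κ 1 γ - 1))) ∧
      (∀ (A : WeierstrassCurve ℚ) [A.IsElliptic] [A.IsGloballyMinimal],
        A.HasCM → A.analyticRank = 0 → GoodSS A 2 → A.frobeniusTrace 2 = 0 →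
        ∀ (κ : ZpExtension ℚ 2) (γ : Field.absoluteGaloisGroup ℚ),
          κ.IsCyclotomic → κ.IsTopGenerator γ → IsCyclotomicVariable 2 γ →
        ∀ (D : SignedSelmerDualData A κ γ 1) [Module.Finite (IwasawaAlgebra 2) D.X],
          Module.IsTorsion (IwasawaAlgebra 2) D.X →
        ∀ g : IwasawaAlgebra 2, D.charIdeal = Ideal.span {g} → Finite (A.selmerGroupPInfty 2) →
          ∃ u : ℤ_[2]ˣ, ((PowerSeries.constantCoeff g : ℤ_[2]) : ℚ_[2]) =
            ((u : ℤ_[2]) : ℚ_[2]) * ((2 : ℕ) : ℚ_[2]) ^ (padicValNat 2 A.tamagawaProduct) *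
              (Nat.card (A.selmerGroupPInfty 2) : ℚ_[2])) ∧
      (∀ (A : WeierstrassCurve ℚ) [A.IsElliptic] [A.IsGloballyMinimal],
        A.HasCM → A.analyticRank = 0 → GoodSS A 2 → A.frobeniusTrace 2 = 0 →
        KobayashiLowerDivisibility A 2 1) ∧
      (∀ (A : WeierstrassCurve ℚ) [A.IsElliptic] [A.IsGloballyMinimal],
        A.HasCM → A.analyticRank = 0 → GoodSS A 2 → A.frobeniusTrace 2 = 0 →
        ∀ [NeZero (A.conductorNorm ℤ)] (f : CuspForm (Gamma0 (A.conductorNorm ℤ)) 2),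
        IsNewformOf A f → ∀ (Lplus Lminus : IwasawaAlgebra 2), IsPollackPair f 2 Lplus Lminus →
          ∃ n : ℕ, IsUnit (PowerSeries.coeff n (kobayashiL 1 Lplus Lminus)))) := by
  obtain ⟨hBF, hmod, hLrat, hGZK, h2⟩ := hPUB
  exact signedMainConjectureCMTwoRankZero_body_iff_rankzero_stubs hBF hmod hLrat hGZK h2

/-- **Corollary (necessity, by name): the crux implies each research stub** — in particular the
LOAD-BEARING Eisenstein half `∀ A …, KobayashiLowerDivisibility A 2 1` and Kim's term at `2` — granted PUB; so
every `stub-false` verdict on line `rankzero` refutes item 20312 itself. [cite: Kobayashi2003, Conjecture (p. 2)]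
[cite: BurungaleFlach2024, Thm. 1.1] -/
theorem rankzero_stubs_of_signedMainConjectureCMTwoRankZero
    (hPUB : bsdTriple_of_hasCM_of_L_one_ne_zero ∧ nonempty_modularParametrizationData ∧
      hasEntireLFunction_rat ∧ rank_eq_analyticRank_of_analyticRank_le_one ∧
      Literature.NumberTheory.EllipticCurves.realPeriodRat_eq_unit_mul_plusPeriod_two)
    (hK2 : Summit.BirchSwinnertonDyer.BirchSwinnertonDyer.Theses.ThetaPartnerAtTwo.SignedMainConjectureCMTwoRankZero)
    (A : WeierstrassCurve ℚ) [A.IsElliptic] [A.IsGloballyMinimal]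
    (hcm : A.HasCM) (hr : A.analyticRank = 0) (hss : GoodSS A 2) (ha : A.frobeniusTrace 2 = 0) :
    (∀ (κ : ZpExtension ℚ 2) (γ : Field.absoluteGaloisGroup ℚ),
        κ.IsCyclotomic → κ.IsTopGenerator γ → IsCyclotomicVariable 2 γ →
        Finite (endInvariants (conjSignedSelmerInfty A κ 1 γ - 1))) ∧
    (∀ (κ : ZpExtension ℚ 2) (γ : Field.absoluteGaloisGroup ℚ),
        κ.IsCyclotomic → κ.IsTopGenerator γ → IsCyclotomicVariable 2 γ →
        ∀ (D : SignedSelmerDualData A κ γ 1) [Module.Finite (IwasawaAlgebra 2) D.X],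
          Module.IsTorsion (IwasawaAlgebra 2) D.X →
        ∀ g : IwasawaAlgebra 2, D.charIdeal = Ideal.span {g} → Finite (A.selmerGroupPInfty 2) →
          ∃ u : ℤ_[2]ˣ, ((PowerSeries.constantCoeff g : ℤ_[2]) : ℚ_[2]) =
            ((u : ℤ_[2]) : ℚ_[2]) * ((2 : ℕ) : ℚ_[2]) ^ (padicValNat 2 A.tamagawaProduct) *
              (Nat.card (A.selmerGroupPInfty 2) : ℚ_[2])) ∧
    KobayashiLowerDivisibility A 2 1 ∧
    (∀ [NeZero (A.conductorNorm ℤ)] (f : CuspForm (Gamma0 (A.conductorNorm ℤ)) 2),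
      IsNewformOf A f → ∀ (Lplus Lminus : IwasawaAlgebra 2), IsPollackPair f 2 Lplus Lminus →
        ∃ n : ℕ, IsUnit (PowerSeries.coeff n (kobayashiL 1 Lplus Lminus))) := by
  obtain ⟨hBF, hmod, hLrat, hGZK, h2⟩ := hPUB
  exact rankzero_stubs_of_signedMainConjectureCMTwo_at A hBF hmod hLrat hGZK h2 hcm hss ha hr
    (hK2 A hcm hr hss ha)

/-- **Crux K2r ⟺ the four research stubs of the REGISTERED skeleton `rankzero` v7, verbatim** (Kim's
term at ALL cyclotomic top-generator pairs, as registered on item stmt-BirchSwinnertonDyer-20312): the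
previous equivalence combined with the pair-independence of Kim's Euler-characteristic identity
(`Kobayashi2003.kimEulerChar_of_kimEulerChar_normalised`: from the normalised pairs to all pairs; the
converse restriction is trivial). Granted PUB, every registered research stub is therefore NECESSARY and
their conjunction is SUFFICIENT. [cite: BDKim2013, Cor. 3.15 (p odd in print)]
[cite: GreenbergLNM1716, §1 p. 60 and Lemma 4.2] [cite: PollackRubin2004, Thm. 7.3 (p > 2 in print)] -/
theorem signedMainConjectureCMTwoRankZero_iff_rankzero_stubs_v7
    (hPUB : bsdTriple_of_hasCM_of_L_one_ne_zero ∧ nonempty_modularParametrizationData ∧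
      hasEntireLFunction_rat ∧ rank_eq_analyticRank_of_analyticRank_le_one ∧
      Literature.NumberTheory.EllipticCurves.realPeriodRat_eq_unit_mul_plusPeriod_two) :
    Summit.BirchSwinnertonDyer.BirchSwinnertonDyer.Theses.ThetaPartnerAtTwo.SignedMainConjectureCMTwoRankZero ↔
    ((∀ (A : WeierstrassCurve ℚ) [A.IsElliptic] [A.IsGloballyMinimal],
        A.HasCM → A.analyticRank = 0 → GoodSS A 2 → A.frobeniusTrace 2 = 0 →
        ∀ (κ : ZpExtension ℚ 2) (γ : Field.absoluteGaloisGroup ℚ),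
          κ.IsCyclotomic → κ.IsTopGenerator γ → IsCyclotomicVariable 2 γ →
          Finite (endInvariants (conjSignedSelmerInfty A κ 1 γ - 1))) ∧
      (∀ (A : WeierstrassCurve ℚ) [A.IsElliptic] [A.IsGloballyMinimal],
        A.HasCM → A.analyticRank = 0 → GoodSS A 2 → A.frobeniusTrace 2 = 0 →
        ∀ (κ : ZpExtension ℚ 2) (γ : Field.absoluteGaloisGroup ℚ), κ.IsCyclotomic → κ.IsTopGenerator γ →
        ∀ (D : SignedSelmerDualData A κ γ 1) [Module.Finite (IwasawaAlgebra 2) D.X],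
          Module.IsTorsion (IwasawaAlgebra 2) D.X →
        ∀ g : IwasawaAlgebra 2, D.charIdeal = Ideal.span {g} → Finite (A.selmerGroupPInfty 2) →
          ∃ u : ℤ_[2]ˣ, ((PowerSeries.constantCoeff g : ℤ_[2]) : ℚ_[2]) =
            ((u : ℤ_[2]) : ℚ_[2]) * ((2 : ℕ) : ℚ_[2]) ^ (padicValNat 2 A.tamagawaProduct) *
              (Nat.card (A.selmerGroupPInfty 2) : ℚ_[2])) ∧
      (∀ (A : WeierstrassCurve ℚ) [A.IsElliptic] [A.IsGloballyMinimal],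
        A.HasCM → A.analyticRank = 0 → GoodSS A 2 → A.frobeniusTrace 2 = 0 →
        KobayashiLowerDivisibility A 2 1) ∧
      (∀ (A : WeierstrassCurve ℚ) [A.IsElliptic] [A.IsGloballyMinimal],
        A.HasCM → A.analyticRank = 0 → GoodSS A 2 → A.frobeniusTrace 2 = 0 →
        ∀ [NeZero (A.conductorNorm ℤ)] (f : CuspForm (Gamma0 (A.conductorNorm ℤ)) 2),
        IsNewformOf A f → ∀ (Lplus Lminus : IwasawaAlgebra 2), IsPollackPair f 2 Lplus Lminus →
          ∃ n : ℕ, IsUnit (PowerSeries.coeff n (kobayashiL 1 Lplus Lminus)))) := by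
  rw [signedMainConjectureCMTwoRankZero_iff_rankzero_stubs hPUB]
  constructor
  · rintro ⟨hT2, hKim, hlow, hflat⟩
    refine ⟨hT2, fun A _ _ hcm hr hss ha => ?_, hlow, hflat⟩
    exact Kobayashi2003.kimEulerChar_of_kimEulerChar_normalised A 1 (hKim A hcm hr hss ha)
  · rintro ⟨hT2, hKim, hlow, hflat⟩
    exact ⟨hT2, fun A _ _ hcm hr hss ha κ γ hκ hγ _ D _ hT g hg hfin =>
      hKim A hcm hr hss ha κ γ hκ hγ D hT g hg hfin, hlow, hflat⟩

end Summit.BirchSwinnertonDyer.BirchSwinnertonDyer.Theorems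

end
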